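import Literature.Geometry.Riemannian.ThreeShrinkerDegenerateDeck
import Literature.Geometry.Riemannian.LocalIsometryLintegral
import HarnessLib

/-!
# Degenerate three-dimensional shrinkers: the fibres of the developing map and the weighted volume

Conclusion of the degenerate case of Munteanu–Wang 2016, Thm. 1.2 (route via Cartan's developing
map, see `ThreeShrinkerDegenerateDevelopingGlue`, `…Covering`, `…Deck`). For a developing map
`Φ : C → M`:

* `mem_deckSet_cases` — every deck map is `id`, the antipodal map `α(y) = −y`, or the antipodal
  inversion `σ₀(y) = −y/|y|²`: `f_C`-invariance forces the scale `c = 1`; a linear deck map `Q ≠ 1`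
  acts freely, so `det Q = −1` (Euler), `−Q` fixes a vector `v`, `Q² ` fixes `v`, hence `Q² = 1`
  (freeness of `m ∘ m`) and `Q = −1`; an inversion `y ↦ Qy/|y|²` squares to the linear deck map
  `Q²`, which fixes a vector (`det Q² = 1`), so `Q² = 1`, and `Q` has no fixed vector (else the
  unit fixed vector is a fixed point), so `Q = −1`;
* `not_antipode_and_antiInv` — `α ∘ σ₀ = (y ↦ y/|y|²)` fixes the unit sphere, so not both occur;
* `fibre_card` — with transitivity (`exists_deck_apply_eq`) every fibre of `Φ` has exactly
  `k ∈ {1, 2}` points;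
* `lintegral_exp_neg_f` — **the weighted volume**: `∫_C e^{−f_C} = k ∫_M e^{−f}`
  (`RiemannianCovering.lintegral_comp_eq_mul_of_card_fibre`) and `∫_C e^{−f_C} = 16π√π/e`
  (`RoundCylinderThree.lintegral_exp_neg_fP`), so `∫_M e^{−f} dV ∈ {16π√π/e, 8π√π/e}`.

Everything is proved; no new definitions besides abbreviations (D-0026).

## References

* O. Munteanu, J. Wang, arXiv:1606.01861, Thm. 1.2 (p. 3). [MunteanuWang2016]
* B. O'Neill, *Semi-Riemannian Geometry*, Academic Press 1983, Ch. 7, Cor. 29. [ONeill1983]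
* H. Federer, *Geometric Measure Theory*, Springer 1969, §3.2.46. [Federer1969]
-/

noncomputable section

open Bundle Set Function Filter Module Metric MeasureTheory
open scoped Manifold ContDiff Topology NNReal ENNReal RealInnerProductSpace

namespace Literature.Geometry.Riemannian

open Lorentzian Lorentzian.PseudoRiemannianMetric RoundCylinderThree

variable {M : Type*} [TopologicalSpace M] [ChartedSpace (EuclideanSpace ℝ (Fin 3)) M]
  [IsManifold (𝓡 3) ∞ M]
  {g : PseudoRiemannianMetric (𝓡 3) ∞ (EuclideanSpace ℝ (Fin 3)) (TangentSpace (𝓡 3) : M → Type _)}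
  [g.HasLeviCivita] {f : M → ℝ} {Φ : P3 → M}

namespace DegenerateShrinker

namespace IsDeveloping

/-! ### Elementary evaluations of model maps -/

/-- A point of `C` from a nonzero vector. [folklore] -/
abbrev pt (v : E3) (hv : v ≠ 0) : P3 := ⟨v, hv⟩

/-- `f_C ∘ m = f_C` for a deck map. [folklore] -/
theorem fP_deck (hdev : IsDeveloping g f Φ) {m : P3 → P3} (hm : m ∈ deckSet Φ) (y : P3) :
    fP (m y) = fP y := by
  rw [← hdev.potential (m y), hm.2, hdev.potential]

/-- If a linear deck map `y ↦ Qy` is in the deck set, `Q` fixes `Q`-fixed points … : evaluation of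
`scaleLin 1 Q` at `⟨v⟩`. [folklore] -/
theorem coe_scaleLin_one {Q : E3 →L[ℝ] E3} (hQ : IsOrtho Q) (y : P3) :
    ((scaleLin 1 Q y : P3) : E3) = Q y := by
  rw [coe_scaleLin one_pos hQ, linE, one_smul]

/-- `scaleLin 1 Q = id` forces `Q v = v` for all `v`. [folklore] -/
theorem apply_eq_of_scaleLin_eq_id {Q : E3 →L[ℝ] E3} (hQ : IsOrtho Q)
    (h : scaleLin 1 Q = _root_.id) (v : E3) : Q v = v := by
  by_cases hv : v = 0
  · rw [hv, map_zero]
  · have e := congrArg (fun F : P3 → P3 ↦ ((F (pt v hv) : P3) : E3)) h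
    rw [coe_scaleLin_one hQ] at e
    exact e

/-! ### Classification of deck maps -/

/-- **Every deck map is `id`, `α` or `σ₀`.** [cite: MunteanuWang2016, Thm. 1.2]
[cite: ONeill1983, Ch. 7, Cor. 29] -/
theorem mem_deckSet_cases (hdev : IsDeveloping g f Φ) {m : P3 → P3} (hm : m ∈ deckSet Φ) :
    m = _root_.id ∨ m = antipode ∨ m = antiInv := by
  have hm' := hm
  obtain ⟨⟨c, Q, hc, hQ, hmQ⟩, hΦm⟩ := hm
  have hfP := hdev.fP_deck hm'
  rcases hmQ with rfl | rfl
  · -- linear deck maps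
    have hc1 : c = 1 := eq_one_of_fP_scaleLin hc hQ o₀ (hfP _)
    subst hc1
    by_cases hQid : ∀ v, Q v = v
    · left
      funext y
      apply Subtype.ext
      rw [coe_scaleLin_one hQ, hQid]
      rfl
    · right; left
      push Not at hQid
      -- `Q` has no nonzero fixed vector (freeness)
      have hnofix : ∀ v, Q v = v → v = 0 := by
        intro v hv
        by_contra hv0
        have hfix : scaleLin 1 Q (pt v hv0) = pt v hv0 :=
          Subtype.ext (by rw [coe_scaleLin_one hQ, hv])
        have hid := hdev.deck_eq_id hm' hfix
        obtain ⟨w, hw⟩ := hQid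
        exact hw (apply_eq_of_scaleLin_eq_id hQ hid w)
      -- `det Q = −1`, so `−Q` fixes a vector: `Q v = −v`
      have hdet : LinearMap.det (Q : E3 →ₗ[ℝ] E3) = -1 :=
        hQ.det_eq_or.resolve_left fun h1 ↦ by
          obtain ⟨v, hv0, hv⟩ := hQ.exists_fixed_of_det_eq_one h1
          exact hv0 (hnofix v hv)
      have hdet' : LinearMap.det ((-Q : E3 →L[ℝ] E3) : E3 →ₗ[ℝ] E3) = 1 := by
        rw [det_neg, hdet, neg_neg]
      obtain ⟨v, hv0, hv⟩ := hQ.neg.exists_fixed_of_det_eq_one hdet'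
      have hQv : Q v = -v := by
        have h : -(Q v) = v := hv
        exact neg_eq_iff_eq_neg.1 h
      -- `m ∘ m` fixes `⟨v⟩`, hence `Q² = 1`
      have hmm : scaleLin 1 Q ∘ scaleLin 1 Q ∈ deckSet Φ := comp_mem_deckSet hm' hm'
      have hfix2 : (scaleLin 1 Q ∘ scaleLin 1 Q) (pt v hv0) = pt v hv0 := by
        apply Subtype.ext
        rw [Function.comp_apply, coe_scaleLin_one hQ, coe_scaleLin_one hQ]
        change Q (Q v) = v
        rw [hQv, map_neg, hQv, neg_neg]
      have hsq := hdev.deck_eq_id hmm hfix2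
      rw [scaleLin_scaleLin one_pos hQ one_pos hQ, one_mul] at hsq
      have h2 : ∀ u, Q (Q u) = u := fun u ↦ apply_eq_of_scaleLin_eq_id (hQ.comp hQ) hsq u
      have hQneg : ∀ u, Q u = -u := eq_neg_of_sq_eq h2 hnofix
      funext y
      apply Subtype.ext
      rw [coe_scaleLin_one hQ, hQneg, coe_antipode]
  · -- inversions
    have hc1 : c = 1 := eq_one_of_fP_scaleInv hc hQ o₀ (hfP _)
    subst hc1
    right; right
    -- `m ∘ m = scaleLin 1 Q²` fixes a vector (`det Q² = 1`), hence `Q² = 1`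
    have hmm : scaleInv 1 Q ∘ scaleInv 1 Q ∈ deckSet Φ := comp_mem_deckSet hm' hm'
    rw [scaleInv_scaleInv one_pos hQ one_pos hQ, div_one] at hmm
    have hdet2 : LinearMap.det ((Q.comp Q : E3 →L[ℝ] E3) : E3 →ₗ[ℝ] E3) = 1 := by
      rw [det_comp]
      rcases hQ.det_eq_or with h | h <;> rw [h] <;> norm_num
    obtain ⟨v, hv0, hv⟩ := (hQ.comp hQ).exists_fixed_of_det_eq_one hdet2
    have hfix2 : scaleLin 1 (Q.comp Q) (pt v hv0) = pt v hv0 :=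
      Subtype.ext (by rw [coe_scaleLin_one (hQ.comp hQ)]; exact hv)
    have hsq := hdev.deck_eq_id hmm hfix2
    have h2 : ∀ u, Q (Q u) = u := fun u ↦ apply_eq_of_scaleLin_eq_id (hQ.comp hQ) hsq u
    -- `Q` has no nonzero fixed vector: else the unit fixed vector is a fixed point of `m`
    have hnofix : ∀ v, Q v = v → v = 0 := by
      intro v hv
      by_contra hv0
      have hn : ‖v‖ ≠ 0 := norm_ne_zero_iff.2 hv0
      set e : E3 := ‖v‖⁻¹ • v with he
      have he1 : ‖e‖ = 1 := by
        rw [he, norm_smul, norm_inv, norm_norm, inv_mul_cancel₀ hn]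
      have he0 : e ≠ 0 := fun h ↦ by rw [h, norm_zero] at he1; exact zero_ne_one he1
      have hQe : Q e = e := by rw [he, map_smul, hv]
      have hfix : scaleInv 1 Q (pt e he0) = pt e he0 := by
        apply Subtype.ext
        rw [coe_scaleInv one_pos hQ, invE, one_mul, hQe]
        change (‖e‖ ^ 2)⁻¹ • e = e
        rw [he1, one_pow, inv_one, one_smul]
      have hid := hdev.deck_eq_id hm' hfix
      have h2e0 : (2 : ℝ) • e ≠ 0 := smul_ne_zero two_ne_zero he0
      have e1 := congrArg (fun F : P3 → P3 ↦ ‖((F (pt _ h2e0) : P3) : E3)‖) hid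
      have e2 : ‖((scaleInv 1 Q (pt _ h2e0) : P3) : E3)‖ = ‖(2 : ℝ) • e‖ := e1
      rw [coe_scaleInv one_pos hQ, norm_invE hQ one_pos h2e0] at e2
      change 1 / ‖(2 : ℝ) • e‖ = ‖(2 : ℝ) • e‖ at e2
      rw [norm_smul, he1, mul_one, Real.norm_eq_abs, abs_of_pos two_pos] at e2
      norm_num at e2
    have hQneg : ∀ u, Q u = -u := eq_neg_of_sq_eq h2 hnofix
    funext y
    apply Subtype.ext
    rw [coe_scaleInv one_pos hQ, invE, one_mul, hQneg, coe_antiInv, smul_neg]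

/-- **`α` and `σ₀` are not both deck maps** (`α ∘ σ₀` fixes the unit sphere but moves `2õ₀`).
[folklore] -/
theorem not_antipode_and_antiInv (hdev : IsDeveloping g f Φ) :
    ¬(antipode ∈ deckSet Φ ∧ antiInv ∈ deckSet Φ) := by
  rintro ⟨h1, h2⟩
  have hmm := comp_mem_deckSet h1 h2
  have hfix : (antipode ∘ antiInv) (basePt o₀) = basePt o₀ := antipode_antiInv_basePt o₀
  have hid := hdev.deck_eq_id hmm hfix
  have ho : (o₀ : E3) ≠ 0 := fun h ↦ by
    have := norm_eq_of_mem_sphere o₀; rw [h, norm_zero] at this; exact zero_ne_one this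
  have h20 : (2 : ℝ) • (o₀ : E3) ≠ 0 := smul_ne_zero two_ne_zero ho
  have hp : ‖(2 : ℝ) • (o₀ : E3)‖ = 2 := by
    rw [norm_smul, norm_eq_of_mem_sphere, mul_one, Real.norm_eq_abs, abs_of_pos two_pos]
  have e1 := congrArg (fun F : P3 → P3 ↦ ‖((F (pt _ h20) : P3) : E3)‖) hid
  have e2 : ‖((antipode (antiInv (pt _ h20)) : P3) : E3)‖ = ‖(2 : ℝ) • (o₀ : E3)‖ := e1
  rw [coe_antipode, coe_antiInv, norm_neg, norm_neg, norm_smul, norm_inv] at e2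
  change ‖‖(2 : ℝ) • (o₀ : E3)‖ ^ 2‖⁻¹ * ‖(2 : ℝ) • (o₀ : E3)‖ = ‖(2 : ℝ) • (o₀ : E3)‖ at e2
  rw [hp, Real.norm_eq_abs] at e2
  norm_num at e2

/-! ### The fibres -/

section Trans

variable [T2Space M] [ConnectedSpace M]
  (hg : ∀ (x : M) (v : TangentSpace (𝓡 3) x), v ≠ 0 → 0 < g.val x v v)
  (hf : ContMDiff (𝓡 3) 𝓘(ℝ, ℝ) ∞ f) {lam : ℝ}
  (hsol : ∀ (x : M) (X Y : TangentSpace (𝓡 3) x),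
    g.ricci x X Y + g.hessian f x X Y = lam * g.val x X Y)
  (hRic0 : ∀ (x : M) (w : TangentSpace (𝓡 3) x), 0 ≤ g.ricci x w w)
  (hS : ∀ x, 0 < g.scalarCurvature x) {p₀ : M} {w₀ : TangentSpace (𝓡 3) p₀} (hw₀ : w₀ ≠ 0)
  (hnull : g.ricci p₀ w₀ w₀ = 0)
  {κ : (x : M) → TangentSpace (𝓡 3) x → ℝ}
  (hκ : ∀ (x : M) (w : TangentSpace (𝓡 3) x),
    κ x w = g.val x w w - 2 / g.scalarCurvature x * g.ricci x w w)

include hg hf hsol hRic0 hS hw₀ hnull hκ in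
/-- **The fibres of the developing map have `k ∈ {1, 2}` points** (`k = 1` when the deck set is
trivial, `k = 2` when it is `{id, α}` or `{id, σ₀}`). [cite: MunteanuWang2016, Thm. 1.2]
[cite: ONeill1983, Ch. 7, Cor. 29] -/
theorem fibre_card (hdev : IsDeveloping g f Φ) (hc : IsGeodesicallyComplete g.leviCivita) :
    ∃ k : ℕ, (k = 1 ∨ k = 2) ∧ ∀ x : M, ∃ s : Finset P3, s.card = k ∧ ∀ y, y ∈ s ↔ Φ y = x := by
  classical
  have hsurj := (hdev.surjective_and_isCoveringMap hc).1
  have htrans : ∀ {y₁ y₂ : P3}, Φ y₁ = Φ y₂ → ∃ m ∈ deckSet Φ, m y₁ = y₂ := fun hx ↦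
    hdev.exists_deck_apply_eq hg hf hsol hRic0 hS hw₀ hnull hκ hx
  by_cases hnt : antipode ∈ deckSet Φ ∨ antiInv ∈ deckSet Φ
  · obtain ⟨σ, hσ, hσne, hall⟩ : ∃ σ ∈ deckSet Φ, (∀ y, σ y ≠ y) ∧
        ∀ m ∈ deckSet Φ, m = _root_.id ∨ m = σ := by
      rcases hnt with h | h
      · refine ⟨antipode, h, antipode_ne, fun m hm ↦ ?_⟩
        rcases hdev.mem_deckSet_cases hm with e | e | e
        · exact Or.inl e
        · exact Or.inr e
        · exact absurd ⟨h, e ▸ hm⟩ hdev.not_antipode_and_antiInv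
      · refine ⟨antiInv, h, antiInv_ne, fun m hm ↦ ?_⟩
        rcases hdev.mem_deckSet_cases hm with e | e | e
        · exact Or.inl e
        · exact absurd ⟨e ▸ hm, h⟩ hdev.not_antipode_and_antiInv
        · exact Or.inr e
    refine ⟨2, Or.inr rfl, fun x ↦ ?_⟩
    obtain ⟨y₀, hy₀⟩ := hsurj x
    refine ⟨{y₀, σ y₀}, ?_, fun y ↦ ?_⟩
    · exact Finset.card_pair (hσne y₀).symm
    · rw [Finset.mem_insert, Finset.mem_singleton]
      constructor
      · rintro (rfl | rfl)
        · exact hy₀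
        · rw [hσ.2, hy₀]
      · intro hy
        obtain ⟨m, hm, hmy⟩ := htrans (hy₀.trans hy.symm)
        rcases hall m hm with rfl | rfl
        · exact Or.inl hmy.symm
        · exact Or.inr hmy.symm
  · push Not at hnt
    refine ⟨1, Or.inl rfl, fun x ↦ ?_⟩
    obtain ⟨y₀, hy₀⟩ := hsurj x
    refine ⟨{y₀}, Finset.card_singleton _, fun y ↦ ?_⟩
    rw [Finset.mem_singleton]
    constructor
    · rintro rfl
      exact hy₀
    · intro hy
      obtain ⟨m, hm, hmy⟩ := htrans (hy₀.trans hy.symm)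
      rcases hdev.mem_deckSet_cases hm with rfl | rfl | rfl
      · exact hmy.symm
      · exact absurd hm hnt.1
      · exact absurd hm hnt.2

include hg hf hsol hRic0 hS hw₀ hnull hκ in
/-- **The weighted volume of a degenerate shrinker**: `∫_M e^{−f} dV ∈ {16π√π/e, 8π√π/e}`
(`∫_C e^{−f_C} dV_c = k · ∫_M e^{−f} dV` with `k ∈ {1,2}` and `∫_C e^{−f_C} dV_c = 16π√π/e`).
[cite: MunteanuWang2016, Thm. 1.2] [cite: Federer1969, §3.2.46] -/
theorem lintegral_exp_neg_f [T3Space M] [SecondCountableTopology M] [MeasurableSpace M] [BorelSpace M]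
    (hdev : IsDeveloping g f Φ) (hc : IsGeodesicallyComplete g.leviCivita) :
    ∫⁻ x, ENNReal.ofReal (Real.exp (-f x)) ∂(riemannianMeasure (g.toContMDiffRiemannianMetric hg)) =
        ENNReal.ofReal (16 * Real.pi * Real.sqrt Real.pi * Real.exp (-1)) ∨
    ∫⁻ x, ENNReal.ofReal (Real.exp (-f x)) ∂(riemannianMeasure (g.toContMDiffRiemannianMetric hg)) =
        ENNReal.ofReal (8 * Real.pi * Real.sqrt Real.pi * Real.exp (-1)) := by
  obtain ⟨k, hk, hfib⟩ := hdev.fibre_card hg hf hsol hRic0 hS hw₀ hnull hκ hc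
  have hu : Measurable fun x : M ↦ ENNReal.ofReal (Real.exp (-f x)) :=
    (hf.continuous.measurable.neg.exp).ennreal_ofReal
  have h := RiemannianCovering.lintegral_comp_eq_mul_of_card_fibre (I₁ := 𝓘(ℝ, E3)) (I₂ := 𝓡 3)
    (g₁ := cyl3) (g₂ := g) (F := Φ) isRiemannian_cyl3 hg hdev.smooth hdev.isLocalDiffeomorph hdev.iso
    IsDeveloping.hdim hfib hu
  have hL : ∫⁻ y : P3, ENNReal.ofReal (Real.exp (-f (Φ y))) ∂(riemannianMeasure hC) =
      ENNReal.ofReal (16 * Real.pi * Real.sqrt Real.pi * Real.exp (-1)) := by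
    rw [← lintegral_exp_neg_fP]
    refine lintegral_congr fun y ↦ ?_
    rw [hdev.potential]
  have hL' : ∫⁻ y : P3, ENNReal.ofReal (Real.exp (-f (Φ y))) ∂(riemannianMeasure hC) =
      k * ∫⁻ x, ENNReal.ofReal (Real.exp (-f x)) ∂(riemannianMeasure (g.toContMDiffRiemannianMetric hg)) :=
    h
  rw [hL] at hL'
  rcases hk with rfl | rfl
  · left
    rw [Nat.cast_one, one_mul] at hL'
    exact hL'.symm
  · right
    have h2 : (2 : ℝ≥0∞) ≠ 0 := two_ne_zero
    have h2' : (2 : ℝ≥0∞) ≠ ⊤ := ENNReal.ofNat_ne_top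
    rw [Nat.cast_ofNat] at hL'
    have e : ∫⁻ x, ENNReal.ofReal (Real.exp (-f x)) ∂(riemannianMeasure (g.toContMDiffRiemannianMetric hg)) =
        ENNReal.ofReal (16 * Real.pi * Real.sqrt Real.pi * Real.exp (-1)) / 2 :=
      (ENNReal.eq_div_iff h2 h2').2 hL'.symm
    have hB : 0 ≤ 8 * Real.pi * Real.sqrt Real.pi * Real.exp (-1) := by positivity
    rw [e, show (16 * Real.pi * Real.sqrt Real.pi * Real.exp (-1)) =
      (8 * Real.pi * Real.sqrt Real.pi * Real.exp (-1)) * 2 by ring, ENNReal.ofReal_mul hB,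
      ENNReal.ofReal_ofNat, mul_div_assoc, ENNReal.div_self h2 h2', mul_one]

end Trans

end IsDeveloping

end DegenerateShrinker

end Literature.Geometry.Riemannian

end
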